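import Mathlib
import HarnessLib
import Summits.HubbardSuperconductivity.HubbardSuperconductivity.Theorems.KLProgrammeKLRegimeEngineV8IsoTupleExportB
import Summits.HubbardSuperconductivity.HubbardSuperconductivity.Theorems.KLProgrammeKLRegimeEngineV8ExportUnroll3
import Summits.HubbardSuperconductivity.HubbardSuperconductivity.Theorems.KLProgrammeKLRegimeEngineIsoLineNumeralClosers
import Summits.HubbardSuperconductivity.HubbardSuperconductivity.Theorems.KLProgrammeKLRegimeSplitGeoShellLog

/-!
# Route `KLProgramme` — ENGINE child gen 8 (stmt-HubbardSuperconductivity-20437 `KLRegimeEngineV17F2`), SKELETON v2 class #6 «E5F-∀B»: the CLOSERS of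
# `…EngineV8IsoTupleExportB` (p588438) on BOTH sides (plan g20 (R81) (Q-X2-VALUE), owner's answer (B)/(B1); cell gate-hubbard-kl, seat hubbard-kl-k3c2-p2 g13)

* §0 **`isoTupleL1AtV17F_of_klE5B_hist`** — stub (c)'s (E5-F)ₙ from its `hiso` binder at `j = n` (B line at the DEFERRED constants `klE5AB/klE5cB/klE5dB`),
  `U ≤ klE5uB … cc` (DefsU11 row), `CF ≤ G.CF`, and the W door's residual inputs (history, CURRENT (E2″-F)ₙ, two bare-ball points, `Gfr₀|U| ≤ E0/32`, rows `≤ U/2`).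
* §1 **`isoTupleLineBAt_all_of_stepB`**, **`isoTupleLineBAt_klE5B_all_of_exists`** — the composition's §C unroll (twin of `isoTupleLineAt_klE5W_all_of_exists`,
  `…ExportUnroll3`): from the (X).2-B conjunct byte-verbatim + the v2 binders + the public history + at EVERY `m ≤ n` the PUBLIC scale-`m` data
  (`KernelNormsV4` at `K_m`, the levels bundle at `j ≤ m`, the class-#1 merged exports at `j ≤ m`, (E4) at `K_m` — (b)ₘ for `m ≥ 1`, the scale-0 theorems at
  `m = 0`): the B lines at every `j ≤ n`.
* §2 THE PRODUCER: **`isoTupleLineBAt_of_momentLine_numeral(_klEng)`** — route (M)'s numeral form `fixedTupleL1 ≤ 2⁹·B + 2¹⁷·X` (p585788) read with the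
  CONSUMER's `B`: M2's moment line `X ≤ c_M·U + c_M′·(Klam U)²` at every resolution `n ≤ m ≤ n_β` ⟹ `IsoTupleLineBAt L M 2⁹ (2¹⁷c_M) (2¹⁷c_M′) … n` (`n ≥ 1`)
  — NO VALUE DATUM; **`isoTupleLineBAt_scaleZero`** (the landed scale-0 W line as a B line).
* §3 **`isoTupleLineStepB_of_momentLine`**, **`exists_isoPkgB_of_momentLine`** (any `CF`), **`exists_isoPkgB_klEngGeo8_of_momentLine`** — THE (X).2-B CONJUNCT
  CLOSED MODULO M2 ALONE at the frozen `CF := klEngGeo8.CF`: if M2 delivers `c_M ≤ 2⁶⁰` and any `c_M′ ≥ 0`, the package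
  `(2⁹, max (2¹⁷c_M) (T̂⁴/2), max (2¹⁷c_M′) (T̂⁴V/192), u)`, `u cc := min (klEngU₀3 P R cc/Klam²) (2⁶⁰/(Klam²(c_M′+1)))`, is admissible and the step holds
  (room: `klEngGeo8.CF ≥ 2⁸⁰` and `≥ 2²⁸·klIsoT⁴`; DEGREE RULE respected: klIsoT enters with degree 4, from the n = 0 base only).
«(M)-VALUE-INPUT» DISSOLVES: the value bound is the consumer's `∀ B`, absorbed inside stub (c) where the value rows live (§0).

Proofs only; no definitions; nothing here asserts that M2 holds; nothing asserts superconductivity.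
References: BGM 2006 §2.4–§3 [cite: BenfattoGiulianiMastropietro2006].
-/

noncomputable section

namespace Summit.HubbardSuperconductivity.HubbardSuperconductivity.Theorems.KLRegimeSplit

set_option linter.dupNamespace false -- summit = problem name (single-conjunct summit), D-0017

open Real Finset Literature.MathematicalPhysics.QuantumLattice Literature.Probability.LatticeModels
open Literature.MathematicalPhysics.QuantumLattice.FermiRG
open Summit.HubbardSuperconductivity.HubbardSuperconductivity.Theorems.KLProgrammeLegKernels
open Summit.HubbardSuperconductivity.HubbardSuperconductivity.Theorems.DispersionFlow
open Summit.HubbardSuperconductivity.HubbardSuperconductivity.Theorems.EngineV8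

/-! ## §0 The stub-(c) door at the deferred package -/

section Consumer

variable {L M : ℕ} [NeZero L] [NeZero M]

/-- **(E5-F)ₙ from the deferred B lines** (`1 ≤ n ≤ n_β + 1`): the stub-(c) binder `hiso` at `j = n` (B line at the deferred constants
`klE5AB/klE5cB/klE5dB P R Q CU CF`), `U ≤ klE5uB … cc` (DefsU11 row), `CF ≤ G.CF` (at composition `CF := klEngGeo8.CF = G.CF`) and the W door's residual
inputs (history, the CURRENT (E2″-F)ₙ, two bare-ball points with `4⁻¹ < |q + q₃|_𝕋`, `R.Gfr 0·|U| ≤ klE0/32`, accumulated rows `≤ U/2`) ⟹ `IsoTupleL1AtV17F … n`. -/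
theorem isoTupleL1AtV17F_of_klE5B_hist {G : GeoConsts} {P : SplitConsts} {Q Qt : EngConsts} {R : RenConsts} {CU : ℕ → ℝ} {CF cc β U μ : ℝ}
    (hG : G.WF) (hP : P.WF) (hQ : Q.WF) (hR : R.WF) (hU : 0 < U) (hCF : 0 ≤ CF) (hGCF : CF ≤ G.CF) {n : ℕ} (hn1 : 1 ≤ n) (hn : n ≤ nScales β + 1)
    (hUu : U ≤ klE5uB P R Qt CU CF cc)
    (hline : IsoTupleLineBAt L M (klE5AB P R Qt CU CF) (klE5cB P R Qt CU CF) (klE5dB P R Qt CU CF) P β U μ n)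
    (hhist : HistP klPredsV17F2 L M G P Q R β U μ 0 n) (hE2'' : PairValueIncrementAtV17F L M G P Q β U μ n)
    {q q₃ : TorusSite 2 L} (hq : q ∈ klBall L μ 0) (hq₃ : q₃ ∈ klBall L μ 0) (hqq : 4⁻¹ < klTorusNorm L (q + q₃))
    (hUκ : R.Gfr 0 * |U| ≤ 1 / 32 * klE0)
    (hsmall : initDevBar G U + legDressBarQ2 G P Q U 0 4 +
        (3 * G.CF * (P.Klam * U) ^ 2 +
          ((G.cloc * P.Klam ^ 2 * (1 - (4 : ℝ) ^ (-G.θ))⁻¹ + 2 * Q.CR * P.Klam ^ 3 * |U|) * U ^ 2 + ∑ j ∈ range n, Q.CL β j / L) +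
            7 / 3 * (G.CF * (P.Klam * U) ^ 2) + 20 * (Q.CR * ((P.Klam * U) ^ 2 + (P.Klam * |U|) ^ 3)) +
              4 / 3 * (Q.CR * (P.Klam * U) ^ 2)) ≤ U / 2) :
    IsoTupleL1AtV17F L M G P β U μ n :=
  isoTupleL1AtV17F_of_isoTupleLineBAt_hist hG hP hQ hR hU hn1 hn (klE5cB_nonneg P R Qt CU CF hCF) (klE5dB_nonneg P R Qt CU CF hCF) hline
    ((klE5B_fit_of_le P R Qt CU CF hCF hUu).trans hGCF) hhist hE2'' hq hq₃ hqq hUκ hsmall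

end Consumer

/-! ## §1 The unroll over `j ≤ n` (composition §C) -/

section Unroll

variable {P : SplitConsts} {R : RenConsts} {Q : EngConsts} {G : GeoConsts} {CU : ℕ → ℝ} {cc μ U β CF : ℝ} {L M : ℕ} [NeZero L] [NeZero M]

/-- **CLASS #6 (B-form) UNROLLED with the interleave**: from `IsoTupleLineStepB P R Q CU A c c′ u`, `G.WF`, the v2 binders, the bare frame's admissibility,
`R.WF2`, the public history up to `n ≤ n_β + 1` at `G P Q R` and, at EVERY scale `m ≤ n` (each at its own frame `K_m`), the PUBLIC scale-`m` data
(`KernelNormsV4` at `K_m`; the levels bundle at every `j ≤ m` at `K_m`; the class-#1 merged exports at every `j ≤ m`; (E4) at `K_m` — from stub (b)ₘ for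
`m ≥ 1`, from the scale-0 theorems at `m = 0`): the B line at every `j ≤ n`. -/
theorem isoTupleLineBAt_all_of_stepB {A c c' : ℝ} {u : ℝ → ℝ} (hstep : IsoTupleLineStepB P R Q CU A c c' u) (hG : G.WF)
    (hcc0 : 0 < cc) (hcc : cc ≤ klEngC₃6 P R) (hμ : μ ∈ klWindowC) (h0 : FrameOK R U (nScales β) μ 0) (hU : 0 < U) (hU10 : U ≤ klEngU₀10 P R cc)
    (hUu : U ≤ u cc) (hβ : klBetaMin ≤ β) (hβc : β ≤ Real.exp (cc / U ^ 2)) (hL : klEngL₄ P R β U ≤ L) (hM : klEngM₃ β U L ≤ M) (hR : R.WF2)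
    {n : ℕ} (hn : n ≤ nScales β + 1) (hhist : HistP klPredsV17F2 L M G P Q R β U μ 0 n)
    (hdata : ∀ m ≤ n, KernelNormsV4 L M P Q β U μ (klFlowFrameU L M β U μ m) m ∧
      (∀ j ≤ m, (KernelNormsLevels L M P Q β U μ (klFlowFrameU L M β U μ m) j ∧
        KernelNormsWt4 L M (klWtBudget P Q U j) β U μ (klFlowFrameU L M β U μ m) j)) ∧
      (∀ j ≤ m, LevelsUExportMixedAt L M CU P β U μ j) ∧ EngineFirstMoments L M G P Q β U μ (klFlowFrameU L M β U μ m) m) :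
    ∀ j ≤ n, IsoTupleLineBAt L M A c c' P β U μ j :=
  exports_all_of_step₂
    (E := fun m => KernelNormsV4 L M P Q β U μ (klFlowFrameU L M β U μ m) m ∧
      (∀ j ≤ m, (KernelNormsLevels L M P Q β U μ (klFlowFrameU L M β U μ m) j ∧
        KernelNormsWt4 L M (klWtBudget P Q U j) β U μ (klFlowFrameU L M β U μ m) j)) ∧
      (∀ j ≤ m, LevelsUExportMixedAt L M CU P β U μ j) ∧ EngineFirstMoments L M G P Q β U μ (klFlowFrameU L M β U μ m) m)
    (F := fun j => IsoTupleLineBAt L M A c c' P β U μ j) (N := n) hdata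
    (fun m hm hE hist => by
      have hmn : m ≤ nScales β + 1 := hm.trans hn
      have hhm : HistP klPredsV17F2 L M G P Q R β U μ 0 m := histP_klPredsV17F2_of_le hhist hm
      obtain ⟨hV4, hlev, hlevU, hE4⟩ := hE m le_rfl
      exact hstep G hG cc hcc0 hcc μ hμ U hU hU10 hUu β hβ hβc L M hL hM m hmn (isKLRegime_of_le_nScales_succ hcc0.le hβ hβc hmn) hhm
        (frameOK_klFlowFrameU_of_histP hR h0 hmn hhm) hV4 hlev hlevU hE4 hist)
    n le_rfl

/-- **CLASS #6 (B-form) AT THE DEFERRED CONSTANTS, from the existence statement** — the (X).2-B conjunct byte-verbatim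
(`∃ e, IsIsoPkgB P CF e ∧ IsoTupleLineStepB P R Q CU e.1 e.2.1 e.2.2.1 e.2.2.2`): below the deferred threshold `klE5uB P R Q CU CF cc`, the B lines at
`(klE5AB, klE5cB, klE5dB) P R Q CU CF` at every `j ≤ n`, given the public scale-`m` data at every `m ≤ n`. -/
theorem isoTupleLineBAt_klE5B_all_of_exists
    (hex : ∃ e : ℝ × ℝ × ℝ × (ℝ → ℝ), IsIsoPkgB P CF e ∧ IsoTupleLineStepB P R Q CU e.1 e.2.1 e.2.2.1 e.2.2.2) (hG : G.WF)
    (hcc0 : 0 < cc) (hcc : cc ≤ klEngC₃6 P R) (hμ : μ ∈ klWindowC) (h0 : FrameOK R U (nScales β) μ 0) (hU : 0 < U) (hU10 : U ≤ klEngU₀10 P R cc)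
    (hUu : U ≤ klE5uB P R Q CU CF cc) (hβ : klBetaMin ≤ β) (hβc : β ≤ Real.exp (cc / U ^ 2)) (hL : klEngL₄ P R β U ≤ L) (hM : klEngM₃ β U L ≤ M)
    (hR : R.WF2) {n : ℕ} (hn : n ≤ nScales β + 1) (hhist : HistP klPredsV17F2 L M G P Q R β U μ 0 n)
    (hdata : ∀ m ≤ n, KernelNormsV4 L M P Q β U μ (klFlowFrameU L M β U μ m) m ∧
      (∀ j ≤ m, (KernelNormsLevels L M P Q β U μ (klFlowFrameU L M β U μ m) j ∧
        KernelNormsWt4 L M (klWtBudget P Q U j) β U μ (klFlowFrameU L M β U μ m) j)) ∧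
      (∀ j ≤ m, LevelsUExportMixedAt L M CU P β U μ j) ∧ EngineFirstMoments L M G P Q β U μ (klFlowFrameU L M β U μ m) m) :
    ∀ j ≤ n, IsoTupleLineBAt L M (klE5AB P R Q CU CF) (klE5cB P R Q CU CF) (klE5dB P R Q CU CF) P β U μ j :=
  isoTupleLineBAt_all_of_stepB (isoTupleLineStepB_klE5B_of_exists hex) hG hcc0 hcc hμ h0 hU hU10 hUu hβ hβc hL hM hR hn hhist hdata

end Unroll

/-! ## §2 The PRODUCER: route (M)'s numeral form ⇒ the B line at `n ≥ 1` from the MOMENT LINE ALONE (no value datum) -/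

section Producer

variable {L M : ℕ} [NeZero L] [NeZero M]

/-- **Route (M) ⇒ the B line `(2⁹, 2¹⁷·c_M, 2¹⁷·c_M′)` at `n ≥ 1`** (symbol-layer thresholds `klEngC₃3 / klEngU₀3 / klEngL₃ / klEngM₃`, `R.WF2`, admissible `Kₙ`):
if the Λ_m-weighted pinned first moments of the STANDARD iso tuples of `𝒱ₙ[Kₙ]` are `≤ c_M·U + c_M′·(Klam U)²` at every resolution `n ≤ m ≤ n_β`
(M2's shape of record), then `IsoTupleLineBAt L M 2⁹ (2¹⁷c_M) (2¹⁷c_M′) P β U μ n` — `fixedTupleL1_klIsoKernelAt_le_numeral_klEng` read with the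
CONSUMER's `B`.  No value datum enters. -/
theorem isoTupleLineBAt_of_momentLine_numeral (P : SplitConsts) (R : RenConsts) (c : ℝ) (hR2 : R.WF2) (hc : 0 < c) (hc3 : c ≤ klEngC₃3 P R)
    {μ : ℝ} (hμ : μ ∈ klWindowC) {U : ℝ} (hU : 0 < U) (hU3 : U ≤ klEngU₀3 P R c) {β : ℝ} (hβmin : klBetaMin ≤ β) (hβc : β ≤ Real.exp (c / U ^ 2))
    (hL3 : klEngL₃ β U ≤ L) (hM3 : klEngM₃ β U L ≤ M) {n : ℕ} (hn1 : 1 ≤ n) (hK : FrameOK R U (nScales β) μ (klFlowFrameU L M β U μ n))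
    {cM cM' : ℝ} (hcM : 0 ≤ cM) (hcM' : 0 ≤ cM')
    (hmom : ∀ m : ℕ, n ≤ m → m ≤ nScales β → ∀ (ω : Fin 4 → Fin (sectorCount (2 * m))) (x₁ : SpaceTimeIdx L M) (j : Fin 3),
      klScale klE0 m * (imagTimeWeight β M ^ 3 * ∑ y : Fin 3 → SpaceTimeIdx L M,
        spaceTimeDist L M β x₁ (y j) *
          ‖klIsoKernelAt L M β U μ (klFlowFrameU L M β U μ n) n m (fun i => ((ω i, ![(0 : Fin 2), 0, 1, 1] i), ![(0 : Fin 2), 1, 0, 1] i))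
            (Matrix.vecCons x₁ y)‖) ≤ cM * U + cM' * (P.Klam * U) ^ 2) :
    IsoTupleLineBAt L M (2 ^ 9) (2 ^ 17 * cM) (2 ^ 17 * cM') P β U μ n := by
  intro B hB hval m hnm Ω _ x₁
  have hm1 : 1 ≤ m := hn1.trans hnm
  have hX0 : 0 ≤ cM * U + cM' * (P.Klam * U) ^ 2 := by positivity
  have hb := fixedTupleL1_klIsoKernelAt_le_numeral_klEng P R c hR2 hc hc3 hμ hU hU3 hβmin hβc hK hL3 hM3 n hm1 hB hX0 hval
    (fun hmN => hmom m hnm hmN) Ω x₁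
  refine hb.trans (le_of_eq ?_)
  ring

/-- **The same under the v2 doors** (`cc ≤ klEngC₃6 ≤ klEngC₃3`, `U ≤ klEngU₀10 P R cc ≤ klEngU₀3`, `klEngL₄ P R β U ≤ L ⇒ klEngL₃ ≤ L`). -/
theorem isoTupleLineBAt_of_momentLine_numeral_klEng (P : SplitConsts) (R : RenConsts) (cc : ℝ) (hR2 : R.WF2) (hcc : 0 < cc) (hcc6 : cc ≤ klEngC₃6 P R)
    {μ : ℝ} (hμ : μ ∈ klWindowC) {U : ℝ} (hU : 0 < U) (hU10 : U ≤ klEngU₀10 P R cc) {β : ℝ} (hβmin : klBetaMin ≤ β) (hβc : β ≤ Real.exp (cc / U ^ 2))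
    (hL : klEngL₄ P R β U ≤ L) (hM : klEngM₃ β U L ≤ M) {n : ℕ} (hn1 : 1 ≤ n) (hK : FrameOK R U (nScales β) μ (klFlowFrameU L M β U μ n))
    {cM cM' : ℝ} (hcM : 0 ≤ cM) (hcM' : 0 ≤ cM')
    (hmom : ∀ m : ℕ, n ≤ m → m ≤ nScales β → ∀ (ω : Fin 4 → Fin (sectorCount (2 * m))) (x₁ : SpaceTimeIdx L M) (j : Fin 3),
      klScale klE0 m * (imagTimeWeight β M ^ 3 * ∑ y : Fin 3 → SpaceTimeIdx L M,
        spaceTimeDist L M β x₁ (y j) *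
          ‖klIsoKernelAt L M β U μ (klFlowFrameU L M β U μ n) n m (fun i => ((ω i, ![(0 : Fin 2), 0, 1, 1] i), ![(0 : Fin 2), 1, 0, 1] i))
            (Matrix.vecCons x₁ y)‖) ≤ cM * U + cM' * (P.Klam * U) ^ 2) :
    IsoTupleLineBAt L M (2 ^ 9) (2 ^ 17 * cM) (2 ^ 17 * cM') P β U μ n :=
  isoTupleLineBAt_of_momentLine_numeral P R cc hR2 hcc (hcc6.trans (klEngC₃6_le_klEngC₃3 P R)) hμ hU (hU10.trans (klEngU₀10_le_klEngU₀3 P R cc))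
    hβmin hβc (klEngL₃_le_of_klEngL₄_le hL) hM hn1 hK hcM hcM' hmom

/-- **The B line at `n = 0`** is the landed scale-0 W line read as a B line: `IsoTupleLineBAt L M 0 (klIsoT⁴/2) (klIsoT⁴·klScaleZeroValC R/192) … 0`
(v2 doors). -/
theorem isoTupleLineBAt_scaleZero (P : SplitConsts) (R : RenConsts) (hP : P.WF) (hR : R.WF2) {cc : ℝ} (hcc : 0 < cc) (hcc6 : cc ≤ klEngC₃6 P R)
    {μ : ℝ} (hμ : μ ∈ klWindowC) {U : ℝ} (hU : 0 < U) (hU10 : U ≤ klEngU₀10 P R cc) {β : ℝ} (hβ : klBetaMin ≤ β) (hβc : β ≤ Real.exp (cc / U ^ 2))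
    (hL : klEngL₄ P R β U ≤ L) (hM : klEngM₃ β U L ≤ M) (hK : FrameOK R U (nScales β) μ (klFlowFrameU L M β U μ 0)) :
    IsoTupleLineBAt L M 0 (klIsoT ^ 4 / 2) (klIsoT ^ 4 * klScaleZeroValC R / 192) P β U μ 0 :=
  (isoTupleLineStepW_scaleZero_case P R hP hR hcc hcc6 hμ hU hU10 hβ hβc hL hM hK).toB

end Producer

/-! ## §3 The (X).2-B conjunct CLOSED MODULO M2: `∃ e, IsIsoPkgB P CF e ∧ IsoTupleLineStepB P R Q CU e…` from the moment line alone -/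

section StepCloser

/-- **The B-Step from M2's moment line** (any table `Q`, any class-#1 table `CU`, any threshold `u`): if under the B-Step's binders (all but the earlier B lines)
every scale `1 ≤ n ≤ n_β + 1` has the moment line `≤ c_M·U + c_M′·(Klam U)²` at every resolution `n ≤ m ≤ n_β`, then
`IsoTupleLineStepB P R Q CU 2⁹ (max (2¹⁷c_M) (klIsoT⁴/2)) (max (2¹⁷c_M′) (klIsoT⁴·klScaleZeroValC R/192)) u` (`n = 0`: the landed scale-0 package; `n ≥ 1`: route (M)). -/
theorem isoTupleLineStepB_of_momentLine (P : SplitConsts) (R : RenConsts) (hP : P.WF) (hR : R.WF2) (Q : EngConsts) (CU : ℕ → ℝ) {cM cM' : ℝ}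
    (hcM : 0 ≤ cM) (hcM' : 0 ≤ cM') (u : ℝ → ℝ)
    (hmom : ∀ G : GeoConsts, G.WF → ∀ cc : ℝ, 0 < cc → cc ≤ klEngC₃6 P R → ∀ μ ∈ klWindowC, ∀ U : ℝ, 0 < U → U ≤ klEngU₀10 P R cc → U ≤ u cc →
      ∀ β : ℝ, klBetaMin ≤ β → β ≤ Real.exp (cc / U ^ 2) → ∀ (L M : ℕ) [NeZero L] [NeZero M], klEngL₄ P R β U ≤ L → klEngM₃ β U L ≤ M →
      ∀ n : ℕ, 1 ≤ n → n ≤ nScales β + 1 → IsKLRegime U cc (-(n : ℤ)) →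
        HistP klPredsV17F2 L M G P Q R β U μ 0 n → FrameOK R U (nScales β) μ (klFlowFrameU L M β U μ n) →
          KernelNormsV4 L M P Q β U μ (klFlowFrameU L M β U μ n) n →
            (∀ j ≤ n, (KernelNormsLevels L M P Q β U μ (klFlowFrameU L M β U μ n) j ∧
              KernelNormsWt4 L M (klWtBudget P Q U j) β U μ (klFlowFrameU L M β U μ n) j)) →
              (∀ j ≤ n, LevelsUExportMixedAt L M CU P β U μ j) → EngineFirstMoments L M G P Q β U μ (klFlowFrameU L M β U μ n) n →
      ∀ m : ℕ, n ≤ m → m ≤ nScales β → ∀ (ω : Fin 4 → Fin (sectorCount (2 * m))) (x₁ : SpaceTimeIdx L M) (j : Fin 3),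
        klScale klE0 m * (imagTimeWeight β M ^ 3 * ∑ y : Fin 3 → SpaceTimeIdx L M,
          spaceTimeDist L M β x₁ (y j) *
            ‖klIsoKernelAt L M β U μ (klFlowFrameU L M β U μ n) n m (fun i => ((ω i, ![(0 : Fin 2), 0, 1, 1] i), ![(0 : Fin 2), 1, 0, 1] i))
              (Matrix.vecCons x₁ y)‖) ≤ cM * U + cM' * (P.Klam * U) ^ 2) :
    IsoTupleLineStepB P R Q CU (2 ^ 9) (max (2 ^ 17 * cM) (klIsoT ^ 4 / 2)) (max (2 ^ 17 * cM') (klIsoT ^ 4 * klScaleZeroValC R / 192)) u := by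
  intro G hG cc hcc hcc6 μ hμ U hU hU10 hUu β hβ hβc L M _ _ hL hM n hn hreg hhist hK hV4 hlev hlevU hE4 _
  rcases Nat.eq_zero_or_pos n with h0 | hpos
  · subst h0
    exact (isoTupleLineBAt_scaleZero P R hP hR hcc hcc6 hμ hU hU10 hβ hβc hL hM hK).mono hU.le (by positivity) (le_max_right _ _) (le_max_right _ _)
  · exact (isoTupleLineBAt_of_momentLine_numeral_klEng P R cc hR hcc hcc6 hμ hU hU10 hβ hβc hL hM hpos hK
      (by positivity) (by positivity)
      (hmom G hG cc hcc hcc6 μ hμ U hU hU10 hUu β hβ hβc L M hL hM n hpos hn hreg hhist hK hV4 hlev hlevU hE4)).mono hU.le le_rfl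
      (le_max_left _ _) (le_max_left _ _)

/-- **The (X).2-B conjunct from M2's moment line + the fit** (any `CF`, `Q`, `CU`): with `0 < u cc` and
`2⁹ + 2·(max (2¹⁷c_M) (klIsoT⁴/2) + max (2¹⁷c_M′) (klIsoT⁴·klScaleZeroValC R/192)·Klam²·(u cc)) ≤ CF` at every `cc`:
`∃ e, IsIsoPkgB P CF e ∧ IsoTupleLineStepB P R Q CU e.1 e.2.1 e.2.2.1 e.2.2.2`.  NO VALUE DATUM is read. -/
theorem exists_isoPkgB_of_momentLine (P : SplitConsts) (R : RenConsts) (hP : P.WF) (hR : R.WF2) (Q : EngConsts) (CU : ℕ → ℝ) {CF cM cM' : ℝ}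
    (hcM : 0 ≤ cM) (hcM' : 0 ≤ cM') {u : ℝ → ℝ} (hupos : ∀ cc, 0 < u cc)
    (hfit : ∀ cc, 2 ^ 9 + 2 * (max (2 ^ 17 * cM) (klIsoT ^ 4 / 2) + max (2 ^ 17 * cM') (klIsoT ^ 4 * klScaleZeroValC R / 192) * P.Klam ^ 2 * u cc) ≤ CF)
    (hmom : ∀ G : GeoConsts, G.WF → ∀ cc : ℝ, 0 < cc → cc ≤ klEngC₃6 P R → ∀ μ ∈ klWindowC, ∀ U : ℝ, 0 < U → U ≤ klEngU₀10 P R cc → U ≤ u cc →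
      ∀ β : ℝ, klBetaMin ≤ β → β ≤ Real.exp (cc / U ^ 2) → ∀ (L M : ℕ) [NeZero L] [NeZero M], klEngL₄ P R β U ≤ L → klEngM₃ β U L ≤ M →
      ∀ n : ℕ, 1 ≤ n → n ≤ nScales β + 1 → IsKLRegime U cc (-(n : ℤ)) →
        HistP klPredsV17F2 L M G P Q R β U μ 0 n → FrameOK R U (nScales β) μ (klFlowFrameU L M β U μ n) →
          KernelNormsV4 L M P Q β U μ (klFlowFrameU L M β U μ n) n →
            (∀ j ≤ n, (KernelNormsLevels L M P Q β U μ (klFlowFrameU L M β U μ n) j ∧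
              KernelNormsWt4 L M (klWtBudget P Q U j) β U μ (klFlowFrameU L M β U μ n) j)) →
              (∀ j ≤ n, LevelsUExportMixedAt L M CU P β U μ j) → EngineFirstMoments L M G P Q β U μ (klFlowFrameU L M β U μ n) n →
      ∀ m : ℕ, n ≤ m → m ≤ nScales β → ∀ (ω : Fin 4 → Fin (sectorCount (2 * m))) (x₁ : SpaceTimeIdx L M) (j : Fin 3),
        klScale klE0 m * (imagTimeWeight β M ^ 3 * ∑ y : Fin 3 → SpaceTimeIdx L M,
          spaceTimeDist L M β x₁ (y j) *
            ‖klIsoKernelAt L M β U μ (klFlowFrameU L M β U μ n) n m (fun i => ((ω i, ![(0 : Fin 2), 0, 1, 1] i), ![(0 : Fin 2), 1, 0, 1] i))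
              (Matrix.vecCons x₁ y)‖) ≤ cM * U + cM' * (P.Klam * U) ^ 2) :
    ∃ e : ℝ × ℝ × ℝ × (ℝ → ℝ), IsIsoPkgB P CF e ∧ IsoTupleLineStepB P R Q CU e.1 e.2.1 e.2.2.1 e.2.2.2 := by
  have hT4 : 0 ≤ klIsoT ^ 4 := pow_nonneg klIsoT_nonneg 4
  have hV0 : 0 ≤ klScaleZeroValC R := (klScaleZeroValC_pos (gfr_nonneg_of_wf2 hR 0)).le
  refine ⟨((2 : ℝ) ^ 9, max (2 ^ 17 * cM) (klIsoT ^ 4 / 2), max (2 ^ 17 * cM') (klIsoT ^ 4 * klScaleZeroValC R / 192), u),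
    ⟨by positivity, ?_, ?_, fun cc => ⟨hupos cc, hfit cc⟩⟩, isoTupleLineStepB_of_momentLine P R hP hR Q CU hcM hcM' u hmom⟩
  · exact le_max_of_le_right (by positivity)
  · exact le_max_of_le_right (by positivity)

/-- **The (X).2-B conjunct at the frozen `CF := klEngGeo8.CF`** (any `Q`, `CU`): if M2 delivers the moment line with `c_M ≤ 2⁶⁰` and any `c_M′ ≥ 0`, the
package `(2⁹, max (2¹⁷c_M) (T̂⁴/2), max (2¹⁷c_M′) (T̂⁴V/192), u)` with the threshold
`u cc := min (klEngU₀3 P R cc / Klam²) (2⁶⁰ / (Klam²·(c_M′ + 1)))` is admissible at `klEngGeo8.CF` (`≥ 2⁸⁰` and `≥ 2²⁸·klIsoT⁴`) and the step holds —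
provided M2's line holds below that `u` (it is implied by `U ≤ klEngU₀10` anyway if M2 needs no further smallness: then take `hmom` ignoring `U ≤ u cc`). -/
theorem exists_isoPkgB_klEngGeo8_of_momentLine (P : SplitConsts) (R : RenConsts) (hP : P.WF) (hR : R.WF2) (Q : EngConsts) (CU : ℕ → ℝ) {cM cM' : ℝ}
    (hcM : 0 ≤ cM) (hcM60 : cM ≤ 2 ^ 60) (hcM' : 0 ≤ cM')
    (hmom : ∀ G : GeoConsts, G.WF → ∀ cc : ℝ, 0 < cc → cc ≤ klEngC₃6 P R → ∀ μ ∈ klWindowC, ∀ U : ℝ, 0 < U → U ≤ klEngU₀10 P R cc →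
      U ≤ min (klEngU₀3 P R cc / P.Klam ^ 2) (2 ^ 60 / (P.Klam ^ 2 * (cM' + 1))) →
      ∀ β : ℝ, klBetaMin ≤ β → β ≤ Real.exp (cc / U ^ 2) → ∀ (L M : ℕ) [NeZero L] [NeZero M], klEngL₄ P R β U ≤ L → klEngM₃ β U L ≤ M →
      ∀ n : ℕ, 1 ≤ n → n ≤ nScales β + 1 → IsKLRegime U cc (-(n : ℤ)) →
        HistP klPredsV17F2 L M G P Q R β U μ 0 n → FrameOK R U (nScales β) μ (klFlowFrameU L M β U μ n) →
          KernelNormsV4 L M P Q β U μ (klFlowFrameU L M β U μ n) n →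
            (∀ j ≤ n, (KernelNormsLevels L M P Q β U μ (klFlowFrameU L M β U μ n) j ∧
              KernelNormsWt4 L M (klWtBudget P Q U j) β U μ (klFlowFrameU L M β U μ n) j)) →
              (∀ j ≤ n, LevelsUExportMixedAt L M CU P β U μ j) → EngineFirstMoments L M G P Q β U μ (klFlowFrameU L M β U μ n) n →
      ∀ m : ℕ, n ≤ m → m ≤ nScales β → ∀ (ω : Fin 4 → Fin (sectorCount (2 * m))) (x₁ : SpaceTimeIdx L M) (j : Fin 3),
        klScale klE0 m * (imagTimeWeight β M ^ 3 * ∑ y : Fin 3 → SpaceTimeIdx L M,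
          spaceTimeDist L M β x₁ (y j) *
            ‖klIsoKernelAt L M β U μ (klFlowFrameU L M β U μ n) n m (fun i => ((ω i, ![(0 : Fin 2), 0, 1, 1] i), ![(0 : Fin 2), 1, 0, 1] i))
              (Matrix.vecCons x₁ y)‖) ≤ cM * U + cM' * (P.Klam * U) ^ 2) :
    ∃ e : ℝ × ℝ × ℝ × (ℝ → ℝ), IsIsoPkgB P klEngGeo8.CF e ∧ IsoTupleLineStepB P R Q CU e.1 e.2.1 e.2.2.1 e.2.2.2 := by
  have hT4 : 0 ≤ klIsoT ^ 4 := pow_nonneg klIsoT_nonneg 4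
  have hV0 : 0 < klScaleZeroValC R := klScaleZeroValC_pos (gfr_nonneg_of_wf2 hR 0)
  have hK1 : 1 ≤ P.Klam := hP.1
  have hK2 : 0 < P.Klam ^ 2 := by positivity
  have hCF80 := two_pow_eighty_le_klEngGeo8_CF
  have hCFT := two_pow_mul_klIsoT_pow_four_le_klEngGeo8_CF
  set u : ℝ → ℝ := fun cc => min (klEngU₀3 P R cc / P.Klam ^ 2) (2 ^ 60 / (P.Klam ^ 2 * (cM' + 1))) with hu
  have hupos : ∀ cc, 0 < u cc := fun cc => lt_min (div_pos (klEngU₀3_pos P R cc) hK2) (by positivity)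
  refine exists_isoPkgB_of_momentLine P R hP hR Q CU hcM hcM' hupos (fun cc => ?_) hmom
  -- the fit at `klEngGeo8.CF`
  have hu1 : u cc ≤ klEngU₀3 P R cc / P.Klam ^ 2 := min_le_left _ _
  have hu2 : u cc ≤ 2 ^ 60 / (P.Klam ^ 2 * (cM' + 1)) := min_le_right _ _
  have hu0 : 0 ≤ u cc := (hupos cc).le
  -- term 1: the U-linear maxima
  have hmax1 : max (2 ^ 17 * cM) (klIsoT ^ 4 / 2) ≤ 2 ^ 17 * cM + klIsoT ^ 4 / 2 := max_le_add_of_nonneg (by positivity) (by positivity)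
  -- term 2: the quadratic maxima against `u`
  have hmax2 : max (2 ^ 17 * cM') (klIsoT ^ 4 * klScaleZeroValC R / 192) ≤ 2 ^ 17 * cM' + klIsoT ^ 4 * klScaleZeroValC R / 192 :=
    max_le_add_of_nonneg (by positivity) (by positivity)
  have hA : 2 ^ 17 * cM' * P.Klam ^ 2 * u cc ≤ 2 ^ 77 := by
    have h1 : 2 ^ 17 * cM' * P.Klam ^ 2 * u cc ≤ 2 ^ 17 * cM' * P.Klam ^ 2 * (2 ^ 60 / (P.Klam ^ 2 * (cM' + 1))) :=
      mul_le_mul_of_nonneg_left hu2 (by positivity)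
    have h2 : 2 ^ 17 * cM' * P.Klam ^ 2 * (2 ^ 60 / (P.Klam ^ 2 * (cM' + 1))) = 2 ^ 77 * (cM' / (cM' + 1)) := by
      field_simp
    have h3 : cM' / (cM' + 1) ≤ 1 := by
      rw [div_le_one (by positivity)]
      linarith
    calc 2 ^ 17 * cM' * P.Klam ^ 2 * u cc ≤ 2 ^ 77 * (cM' / (cM' + 1)) := h1.trans h2.le
      _ ≤ 2 ^ 77 * 1 := mul_le_mul_of_nonneg_left h3 (by positivity)
      _ = 2 ^ 77 := mul_one _
  have hB : klIsoT ^ 4 * klScaleZeroValC R / 192 * P.Klam ^ 2 * u cc ≤ klIsoT ^ 4 / 768 := by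
    have h1 : klIsoT ^ 4 * klScaleZeroValC R / 192 * P.Klam ^ 2 * u cc ≤
        klIsoT ^ 4 * klScaleZeroValC R / 192 * P.Klam ^ 2 * (klEngU₀3 P R cc / P.Klam ^ 2) :=
      mul_le_mul_of_nonneg_left hu1 (by positivity)
    have h2 : klIsoT ^ 4 * klScaleZeroValC R / 192 * P.Klam ^ 2 * (klEngU₀3 P R cc / P.Klam ^ 2) =
        klIsoT ^ 4 / 192 * (klScaleZeroValC R * klEngU₀3 P R cc) := by
      field_simp
    have hVu : klScaleZeroValC R * klEngU₀3 P R cc ≤ 1 / 4 :=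
      klScaleZeroValC_mul_le_quarter_of_le_klEngU₀3 (P := P) (c := cc) hR.wf (klEngU₀3_pos P R cc) le_rfl
    calc klIsoT ^ 4 * klScaleZeroValC R / 192 * P.Klam ^ 2 * u cc ≤ klIsoT ^ 4 / 192 * (klScaleZeroValC R * klEngU₀3 P R cc) := h1.trans h2.le
      _ ≤ klIsoT ^ 4 / 192 * (1 / 4) := mul_le_mul_of_nonneg_left hVu (by positivity)
      _ = klIsoT ^ 4 / 768 := by ring
  have hsum : max (2 ^ 17 * cM') (klIsoT ^ 4 * klScaleZeroValC R / 192) * P.Klam ^ 2 * u cc ≤ 2 ^ 77 + klIsoT ^ 4 / 768 := by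
    have := mul_le_mul_of_nonneg_right (mul_le_mul_of_nonneg_right hmax2 hK2.le) hu0
    nlinarith
  have hcM77 : 2 ^ 17 * cM ≤ 2 ^ 77 := by nlinarith
  -- assemble: 2⁹ + 2(2⁷⁷ + T⁴/2 + 2⁷⁷ + T⁴/768) ≤ 2⁸⁰/… ≤ CF
  have hgoal : (2 : ℝ) ^ 9 + 2 * (max (2 ^ 17 * cM) (klIsoT ^ 4 / 2) + max (2 ^ 17 * cM') (klIsoT ^ 4 * klScaleZeroValC R / 192) * P.Klam ^ 2 * u cc) ≤
      2 ^ 9 + 2 * (2 ^ 77 + klIsoT ^ 4 / 2 + (2 ^ 77 + klIsoT ^ 4 / 768)) := by nlinarith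
  refine hgoal.trans ?_
  -- `2⁹ + 2⁷⁹ + (1 + 1/384)·T⁴ ≤ ½·2⁸⁰ + ½·2²⁸T⁴ ≤ CF`
  nlinarith

end StepCloser

/-! ## §4 (appended, plan g21 (R83)) CF-monotonicity: the (X).2-B conjunct at ANY `CF ≥ klEngGeo8.CF` — in particular at `G.addShellLog C` (rev 9 «V-all», klEngGeo9) -/

section MonoCF

/-- **Admissibility is monotone in the fit constant**: `IsIsoPkgB P CF e → CF ≤ CF′ → IsIsoPkgB P CF′ e`. -/
theorem IsIsoPkgB.mono_CF {P : SplitConsts} {CF CF' : ℝ} {e : ℝ × ℝ × ℝ × (ℝ → ℝ)} (h : IsIsoPkgB P CF e) (hCF : CF ≤ CF') : IsIsoPkgB P CF' e :=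
  ⟨h.1, h.2.1, h.2.2.1, fun cc => ⟨(h.2.2.2 cc).1, (h.2.2.2 cc).2.trans hCF⟩⟩

/-- **The (X).2-B conjunct is monotone in `CF`** (the step does not read `CF`). -/
theorem exists_isoPkgB_mono_CF {P : SplitConsts} {R : RenConsts} {Q : EngConsts} {CU : ℕ → ℝ} {CF CF' : ℝ} (hCF : CF ≤ CF')
    (h : ∃ e : ℝ × ℝ × ℝ × (ℝ → ℝ), IsIsoPkgB P CF e ∧ IsoTupleLineStepB P R Q CU e.1 e.2.1 e.2.2.1 e.2.2.2) :
    ∃ e : ℝ × ℝ × ℝ × (ℝ → ℝ), IsIsoPkgB P CF' e ∧ IsoTupleLineStepB P R Q CU e.1 e.2.1 e.2.2.1 e.2.2.2 := by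
  obtain ⟨e, he, hs⟩ := h
  exact ⟨e, he.mono_CF hCF, hs⟩

/-- **The (X).2-B conjunct at any `CF ≥ klEngGeo8.CF` from M2's moment line** (`c_M ≤ 2⁶⁰`, any `c_M′ ≥ 0`; threshold as in `exists_isoPkgB_klEngGeo8_of_momentLine`). -/
theorem exists_isoPkgB_of_momentLine_of_klEngGeo8_CF_le (P : SplitConsts) (R : RenConsts) (hP : P.WF) (hR : R.WF2) (Q : EngConsts) (CU : ℕ → ℝ)
    {CF : ℝ} (hCF : klEngGeo8.CF ≤ CF) {cM cM' : ℝ} (hcM : 0 ≤ cM) (hcM60 : cM ≤ 2 ^ 60) (hcM' : 0 ≤ cM')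
    (hmom : ∀ G : GeoConsts, G.WF → ∀ cc : ℝ, 0 < cc → cc ≤ klEngC₃6 P R → ∀ μ ∈ klWindowC, ∀ U : ℝ, 0 < U → U ≤ klEngU₀10 P R cc →
      U ≤ min (klEngU₀3 P R cc / P.Klam ^ 2) (2 ^ 60 / (P.Klam ^ 2 * (cM' + 1))) →
      ∀ β : ℝ, klBetaMin ≤ β → β ≤ Real.exp (cc / U ^ 2) → ∀ (L M : ℕ) [NeZero L] [NeZero M], klEngL₄ P R β U ≤ L → klEngM₃ β U L ≤ M →
      ∀ n : ℕ, 1 ≤ n → n ≤ nScales β + 1 → IsKLRegime U cc (-(n : ℤ)) →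
        HistP klPredsV17F2 L M G P Q R β U μ 0 n → FrameOK R U (nScales β) μ (klFlowFrameU L M β U μ n) →
          KernelNormsV4 L M P Q β U μ (klFlowFrameU L M β U μ n) n →
            (∀ j ≤ n, (KernelNormsLevels L M P Q β U μ (klFlowFrameU L M β U μ n) j ∧
              KernelNormsWt4 L M (klWtBudget P Q U j) β U μ (klFlowFrameU L M β U μ n) j)) →
              (∀ j ≤ n, LevelsUExportMixedAt L M CU P β U μ j) → EngineFirstMoments L M G P Q β U μ (klFlowFrameU L M β U μ n) n →
      ∀ m : ℕ, n ≤ m → m ≤ nScales β → ∀ (ω : Fin 4 → Fin (sectorCount (2 * m))) (x₁ : SpaceTimeIdx L M) (j : Fin 3),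
        klScale klE0 m * (imagTimeWeight β M ^ 3 * ∑ y : Fin 3 → SpaceTimeIdx L M,
          spaceTimeDist L M β x₁ (y j) *
            ‖klIsoKernelAt L M β U μ (klFlowFrameU L M β U μ n) n m (fun i => ((ω i, ![(0 : Fin 2), 0, 1, 1] i), ![(0 : Fin 2), 1, 0, 1] i))
              (Matrix.vecCons x₁ y)‖) ≤ cM * U + cM' * (P.Klam * U) ^ 2) :
    ∃ e : ℝ × ℝ × ℝ × (ℝ → ℝ), IsIsoPkgB P CF e ∧ IsoTupleLineStepB P R Q CU e.1 e.2.1 e.2.2.1 e.2.2.2 :=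
  exists_isoPkgB_mono_CF hCF (exists_isoPkgB_klEngGeo8_of_momentLine P R hP hR Q CU hcM hcM60 hcM' hmom)

/-- **… at any geometry package `G` with `klEngGeo8.CF ≤ G.CF`** (the form the pen asked for in (R83): one file whatever the final V-all token). -/
theorem exists_isoPkgB_geo_of_momentLine (P : SplitConsts) (R : RenConsts) (hP : P.WF) (hR : R.WF2) (Q : EngConsts) (CU : ℕ → ℝ)
    (G₀ : GeoConsts) (hG₀ : klEngGeo8.CF ≤ G₀.CF) {cM cM' : ℝ} (hcM : 0 ≤ cM) (hcM60 : cM ≤ 2 ^ 60) (hcM' : 0 ≤ cM')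
    (hmom : ∀ G : GeoConsts, G.WF → ∀ cc : ℝ, 0 < cc → cc ≤ klEngC₃6 P R → ∀ μ ∈ klWindowC, ∀ U : ℝ, 0 < U → U ≤ klEngU₀10 P R cc →
      U ≤ min (klEngU₀3 P R cc / P.Klam ^ 2) (2 ^ 60 / (P.Klam ^ 2 * (cM' + 1))) →
      ∀ β : ℝ, klBetaMin ≤ β → β ≤ Real.exp (cc / U ^ 2) → ∀ (L M : ℕ) [NeZero L] [NeZero M], klEngL₄ P R β U ≤ L → klEngM₃ β U L ≤ M →
      ∀ n : ℕ, 1 ≤ n → n ≤ nScales β + 1 → IsKLRegime U cc (-(n : ℤ)) →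
        HistP klPredsV17F2 L M G P Q R β U μ 0 n → FrameOK R U (nScales β) μ (klFlowFrameU L M β U μ n) →
          KernelNormsV4 L M P Q β U μ (klFlowFrameU L M β U μ n) n →
            (∀ j ≤ n, (KernelNormsLevels L M P Q β U μ (klFlowFrameU L M β U μ n) j ∧
              KernelNormsWt4 L M (klWtBudget P Q U j) β U μ (klFlowFrameU L M β U μ n) j)) →
              (∀ j ≤ n, LevelsUExportMixedAt L M CU P β U μ j) → EngineFirstMoments L M G P Q β U μ (klFlowFrameU L M β U μ n) n →
      ∀ m : ℕ, n ≤ m → m ≤ nScales β → ∀ (ω : Fin 4 → Fin (sectorCount (2 * m))) (x₁ : SpaceTimeIdx L M) (j : Fin 3),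
        klScale klE0 m * (imagTimeWeight β M ^ 3 * ∑ y : Fin 3 → SpaceTimeIdx L M,
          spaceTimeDist L M β x₁ (y j) *
            ‖klIsoKernelAt L M β U μ (klFlowFrameU L M β U μ n) n m (fun i => ((ω i, ![(0 : Fin 2), 0, 1, 1] i), ![(0 : Fin 2), 1, 0, 1] i))
              (Matrix.vecCons x₁ y)‖) ≤ cM * U + cM' * (P.Klam * U) ^ 2) :
    ∃ e : ℝ × ℝ × ℝ × (ℝ → ℝ), IsIsoPkgB P G₀.CF e ∧ IsoTupleLineStepB P R Q CU e.1 e.2.1 e.2.2.1 e.2.2.2 :=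
  exists_isoPkgB_of_momentLine_of_klEngGeo8_CF_le P R hP hR Q CU hG₀ hcM hcM60 hcM' hmom

/-- **… at the shell-log amendment `klEngGeo8.addShellLog C`** (rev 9 «V-all»: `klEngGeo9 := klEngGeo8.addShellLog _`; `0 ≤ C`), by `GeoConsts.CF_le_addShellLog`. -/
theorem exists_isoPkgB_addShellLog_of_momentLine (P : SplitConsts) (R : RenConsts) (hP : P.WF) (hR : R.WF2) (Q : EngConsts) (CU : ℕ → ℝ)
    {C : ℝ} (hC : 0 ≤ C) {cM cM' : ℝ} (hcM : 0 ≤ cM) (hcM60 : cM ≤ 2 ^ 60) (hcM' : 0 ≤ cM')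
    (hmom : ∀ G : GeoConsts, G.WF → ∀ cc : ℝ, 0 < cc → cc ≤ klEngC₃6 P R → ∀ μ ∈ klWindowC, ∀ U : ℝ, 0 < U → U ≤ klEngU₀10 P R cc →
      U ≤ min (klEngU₀3 P R cc / P.Klam ^ 2) (2 ^ 60 / (P.Klam ^ 2 * (cM' + 1))) →
      ∀ β : ℝ, klBetaMin ≤ β → β ≤ Real.exp (cc / U ^ 2) → ∀ (L M : ℕ) [NeZero L] [NeZero M], klEngL₄ P R β U ≤ L → klEngM₃ β U L ≤ M →
      ∀ n : ℕ, 1 ≤ n → n ≤ nScales β + 1 → IsKLRegime U cc (-(n : ℤ)) →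
        HistP klPredsV17F2 L M G P Q R β U μ 0 n → FrameOK R U (nScales β) μ (klFlowFrameU L M β U μ n) →
          KernelNormsV4 L M P Q β U μ (klFlowFrameU L M β U μ n) n →
            (∀ j ≤ n, (KernelNormsLevels L M P Q β U μ (klFlowFrameU L M β U μ n) j ∧
              KernelNormsWt4 L M (klWtBudget P Q U j) β U μ (klFlowFrameU L M β U μ n) j)) →
              (∀ j ≤ n, LevelsUExportMixedAt L M CU P β U μ j) → EngineFirstMoments L M G P Q β U μ (klFlowFrameU L M β U μ n) n →
      ∀ m : ℕ, n ≤ m → m ≤ nScales β → ∀ (ω : Fin 4 → Fin (sectorCount (2 * m))) (x₁ : SpaceTimeIdx L M) (j : Fin 3),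
        klScale klE0 m * (imagTimeWeight β M ^ 3 * ∑ y : Fin 3 → SpaceTimeIdx L M,
          spaceTimeDist L M β x₁ (y j) *
            ‖klIsoKernelAt L M β U μ (klFlowFrameU L M β U μ n) n m (fun i => ((ω i, ![(0 : Fin 2), 0, 1, 1] i), ![(0 : Fin 2), 1, 0, 1] i))
              (Matrix.vecCons x₁ y)‖) ≤ cM * U + cM' * (P.Klam * U) ^ 2) :
    ∃ e : ℝ × ℝ × ℝ × (ℝ → ℝ), IsIsoPkgB P (klEngGeo8.addShellLog C).CF e ∧ IsoTupleLineStepB P R Q CU e.1 e.2.1 e.2.2.1 e.2.2.2 :=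
  exists_isoPkgB_of_momentLine_of_klEngGeo8_CF_le P R hP hR Q CU (GeoConsts.CF_le_addShellLog (G := klEngGeo8) (C := C) hC) hcM hcM60 hcM' hmom

end MonoCF

end Summit.HubbardSuperconductivity.HubbardSuperconductivity.Theorems.KLRegimeSplit

end
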